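import Summits.CriticalPhenomena.Ising3D.Control2DOpeTail
import Summits.CriticalPhenomena.Ising3D.Control2DL15OpeLBData37
import Summits.CriticalPhenomena.Ising3D.Control2DL15OpeLBData38
import Summits.CriticalPhenomena.Ising3D.Control2DL15OpeLBData39
import Summits.CriticalPhenomena.Ising3D.Control2DL15OpeLBData40
import Summits.CriticalPhenomena.Ising3D.Control2DL15OpeLBData41
import Summits.CriticalPhenomena.Ising3D.Control2DL15OpeLBData42
import Summits.CriticalPhenomena.Ising3D.Control2DL15OpeLBData43
import Summits.CriticalPhenomena.Ising3D.Control2DL15OpeLBData44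
import Summits.CriticalPhenomena.Ising3D.Control2DL15OpeLBData45
import Summits.CriticalPhenomena.Ising3D.Control2DL15OpeLBData46
import Summits.CriticalPhenomena.Ising3D.Control2DL15OpeLBData47
import Summits.CriticalPhenomena.Ising3D.Control2DL15OpeLBData48
import Summits.CriticalPhenomena.Ising3D.Control2DL15OpeLBRegion
import Summits.CriticalPhenomena.Ising3D.Control2DOpeTailKernel
import Mathlib.Tactic.IntervalCases
import Mathlib.Tactic.Linarith
import Mathlib.Tactic.NormNum
import HarnessLib

/-!
# A kind-`ope2` (sense LOWER) 2D γ-certificate in the kernel: `p_T > 38541/2500000` at `Δ_σ = 1/8` under `A2D′` (Λ = 15)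
(cell `pub-ising3x`, seat controls-1 gen 21; KERNEL PATH for the 2D γ-certificates, kind `ope2`, sense lower — CONTROL-ONLY)

HONEST FRAMING: lottery ticket; floor = tightest certified 3D Ising CFT bounds; no exact-solution
claim without a proof. CONTROL-ONLY: `d = 2`, global blocks, `Δ_σ = 1/8` exact, the 2D axiom set `A2D′` with the
CERTIFIED `ε` box `[49/50, 20001/20000]` as scalar input (scalars in the box `∪ [2, ∞)`, stress tensor at `(2,2)` + spin-2 gap `1` — the
ISOLATION that makes a lower bound on `p_T` an exclusion statement, unitarity); nothing about `d = 3`.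

**`opeLower_2d_L15_opeLB : OpeLowerA2D (1/8) 2 1 (49 / 50) (20001 / 20000) (38541/2500000)`** — the total `(2,2)` coefficient obeys
`p_T > 38541/2500000` (by the Virasoro Ward identity `p_T = Δ_σ²/(2c)`: `c < 0.5067655`; cf. the HYPOTHESIS `hlo` of
`cTwoSided_rb6_L15` in `Control2DOpeTwoSided`, which this theorem discharges) — from the RB-6 ope2 (sense lower) certificate `j136827_functional_deriv2d_L15_E040_sig1o8_ope2lower_P38541o2500000.json` (Λ = 15, E₀ = 40): p_T > 38541/2500000 at Δ_σ = 1/8 under A2D′ with the ε box [49/50, 20001/20000] (⇒ c < (1/8)²/(2·38541/2500000) = 0.5067655 by the Ward identity), with EVERY obligation re-decided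
in the Lean kernel: (I′) and the SIGN CHECK `T̂·(95+4-15) + tailZ < 0` (`T̂` = the scalar `T` head at `95 + 1` levels, `tailZ` = the
integer tail majorant of `Control2DOpeTail` / `Control2DOpeTailKernel`) as integer inequalities (`opeLower_half_of_cellsZ`),
(R) by `region_of_kernelCertAuto`, cells `cells_opeLB` (`OpeCellsN`: one integer polynomial per spin from the literal library,
Bernstein leaves; no stress-tensor row). Zero grant compute. No facts, standard axioms only.

`cells_opeLB`: every cell obligation of the certificate ((E) on the ε box, (C′) scalars on [2, E₀), spin 2 on [3, E₀), even spins ≥ 4 on [ℓ, E₀); E₀ = 40), in the witness form `∃ N ≥ E₀` with the spin's own truncation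
order, from the kernel-decided Bernstein leaves of `Control2DL15OpeLBData*` via `cell_nonneg_of_bernCheck`. No facts, standard axioms only.

ONE MODULE for the cells theorem and the assembly (controls-1 g20): every gate dependency level waits for the farm's tree build to catch
up with the freshly landed imports (measured 1–2 h per level under load, `remote:stale:…:unbuilt`), so the cells theorem below is not a
separate `…Cells` module as in the earlier replays; statements and proofs are unchanged.
-/

namespace Summit.CriticalPhenomena.Ising3D.Control2D

open Finset Set
open Literature.MathematicalPhysics.QuantumFieldTheory.ConformalBootstrap3D

set_option maxHeartbeats 0 in
set_option maxRecDepth 200000 in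
/-- **The cells of the certificate** (p_T > 38541/2500000 at Δ_σ = 1/8 under A2D′ with the ε box [49/50, 20001/20000] (⇒ c < (1/8)²/(2·38541/2500000) = 0.5067655 by the Ward identity); `E₀ = 40`; truncation `N = Nd + 1` per spin:
ℓ=0: 64, ℓ=2: 64, ℓ=4: 64, ℓ=6: 64, ℓ=8: 56, ℓ=10: 56 ; others `N = 40`). [folklore] -/
theorem cells_opeLB :
    OpeCellsN slL15.toFinset (fun p => (wtopeLB p : ℝ)) (1 / 8) 2 1 (49 / 50) (20001 / 20000) 40 := by
  refine ⟨?_, ?_, ?_, ?_⟩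
  · intro Δ h1 h2
    refine ⟨63 + 1, by norm_num, ?_⟩
    exact cell_nonneg_of_bernAuto_trunc wtopeLB slL15_nodup slL15_deg 0 63 419 (q := 40000) (a := 19600) (L := 401) (by norm_num) (by norm_num) (by norm_num) (by rw [phatopeLBs0_eq]; exact cellChk_opeLB_s0l0) (by norm_num; linarith) (by norm_num; linarith)
  · intro Δ h1 h2
    replace h2 := h2.le
    refine ⟨63 + 1, by norm_num, ?_⟩
    rcases le_or_gt Δ ((147 : ℝ) / 64) with hd0 | hd0
    · exact cell_nonneg_of_bernAuto_trunc wtopeLB slL15_nodup slL15_deg 0 63 419 (q := 128) (a := 128) (L := 19) (by norm_num) (by norm_num) (by norm_num) (by rw [phatopeLBs0_eq]; exact cellChk_opeLB_s0l1) (by norm_num; linarith) (by norm_num; linarith)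
    rcases le_or_gt Δ ((83 : ℝ) / 32) with hd1 | hd1
    · exact cell_nonneg_of_bernAuto_trunc wtopeLB slL15_nodup slL15_deg 0 63 419 (q := 128) (a := 147) (L := 19) (by norm_num) (by norm_num) (by norm_num) (by rw [phatopeLBs0_eq]; exact cellChk_opeLB_s0l2) (by norm_num; linarith) (by norm_num; linarith)
    rcases le_or_gt Δ ((51 : ℝ) / 16) with hd2 | hd2
    · exact cell_nonneg_of_bernAuto_trunc wtopeLB slL15_nodup slL15_deg 0 63 419 (q := 64) (a := 83) (L := 19) (by norm_num) (by norm_num) (by norm_num) (by rw [phatopeLBs0_eq]; exact cellChk_opeLB_s0l3) (by norm_num; linarith) (by norm_num; linarith)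
    rcases le_or_gt Δ ((121 : ℝ) / 32) with hd3 | hd3
    · exact cell_nonneg_of_bernAuto_trunc wtopeLB slL15_nodup slL15_deg 0 63 419 (q := 64) (a := 102) (L := 19) (by norm_num) (by norm_num) (by norm_num) (by rw [phatopeLBs0_eq]; exact cellChk_opeLB_s0l4) (by norm_num; linarith) (by norm_num; linarith)
    rcases le_or_gt Δ ((261 : ℝ) / 64) with hd4 | hd4
    · exact cell_nonneg_of_bernAuto_trunc wtopeLB slL15_nodup slL15_deg 0 63 419 (q := 128) (a := 242) (L := 19) (by norm_num) (by norm_num) (by norm_num) (by rw [phatopeLBs0_eq]; exact cellChk_opeLB_s0l5) (by norm_num; linarith) (by norm_num; linarith)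
    rcases le_or_gt Δ ((541 : ℝ) / 128) with hd5 | hd5
    · exact cell_nonneg_of_bernAuto_trunc wtopeLB slL15_nodup slL15_deg 0 63 419 (q := 256) (a := 522) (L := 19) (by norm_num) (by norm_num) (by norm_num) (by rw [phatopeLBs0_eq]; exact cellChk_opeLB_s0l6) (by norm_num; linarith) (by norm_num; linarith)
    rcases le_or_gt Δ ((35 : ℝ) / 8) with hd6 | hd6
    · exact cell_nonneg_of_bernAuto_trunc wtopeLB slL15_nodup slL15_deg 0 63 419 (q := 256) (a := 541) (L := 19) (by norm_num) (by norm_num) (by norm_num) (by rw [phatopeLBs0_eq]; exact cellChk_opeLB_s0l7) (by norm_num; linarith) (by norm_num; linarith)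
    rcases le_or_gt Δ ((27 : ℝ) / 4) with hd7 | hd7
    · exact cell_nonneg_of_bernAuto_trunc wtopeLB slL15_nodup slL15_deg 0 63 419 (q := 16) (a := 35) (L := 19) (by norm_num) (by norm_num) (by norm_num) (by rw [phatopeLBs0_eq]; exact cellChk_opeLB_s0l8) (by norm_num; linarith) (by norm_num; linarith)
    rcases le_or_gt Δ ((73 : ℝ) / 8) with hd8 | hd8
    · exact cell_nonneg_of_bernAuto_trunc wtopeLB slL15_nodup slL15_deg 0 63 419 (q := 16) (a := 54) (L := 19) (by norm_num) (by norm_num) (by norm_num) (by rw [phatopeLBs0_eq]; exact cellChk_opeLB_s0l9) (by norm_num; linarith) (by norm_num; linarith)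
    rcases le_or_gt Δ ((311 : ℝ) / 32) with hd9 | hd9
    · exact cell_nonneg_of_bernAuto_trunc wtopeLB slL15_nodup slL15_deg 0 63 419 (q := 64) (a := 292) (L := 19) (by norm_num) (by norm_num) (by norm_num) (by rw [phatopeLBs0_eq]; exact cellChk_opeLB_s0l10) (by norm_num; linarith) (by norm_num; linarith)
    rcases le_or_gt Δ ((641 : ℝ) / 64) with hd10 | hd10
    · exact cell_nonneg_of_bernAuto_trunc wtopeLB slL15_nodup slL15_deg 0 63 409 (q := 128) (a := 622) (L := 19) (by norm_num) (by norm_num) (by norm_num) (by rw [phatopeLBs0_eq]; exact cellChk_opeLB_s0l11) (by norm_num; linarith) (by norm_num; linarith)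
    rcases le_or_gt Δ ((10275 : ℝ) / 1024) with hd11 | hd11
    · exact cell_nonneg_of_bernAuto_trunc wtopeLB slL15_nodup slL15_deg 0 63 399 (q := 2048) (a := 10256) (L := 19) (by norm_num) (by norm_num) (by norm_num) (by rw [phatopeLBs0_eq]; exact cellChk_opeLB_s0l12) (by norm_num; linarith) (by norm_num; linarith)
    rcases le_or_gt Δ ((5147 : ℝ) / 512) with hd12 | hd12
    · exact cell_nonneg_of_bernAuto_trunc wtopeLB slL15_nodup slL15_deg 0 63 399 (q := 2048) (a := 10275) (L := 19) (by norm_num) (by norm_num) (by norm_num) (by rw [phatopeLBs0_eq]; exact cellChk_opeLB_s0l13) (by norm_num; linarith) (by norm_num; linarith)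
    rcases le_or_gt Δ ((2583 : ℝ) / 256) with hd13 | hd13
    · exact cell_nonneg_of_bernAuto_trunc wtopeLB slL15_nodup slL15_deg 0 63 409 (q := 1024) (a := 5147) (L := 19) (by norm_num) (by norm_num) (by norm_num) (by rw [phatopeLBs0_eq]; exact cellChk_opeLB_s0l14) (by norm_num; linarith) (by norm_num; linarith)
    rcases le_or_gt Δ ((1301 : ℝ) / 128) with hd14 | hd14
    · exact cell_nonneg_of_bernAuto_trunc wtopeLB slL15_nodup slL15_deg 0 63 409 (q := 512) (a := 2583) (L := 19) (by norm_num) (by norm_num) (by norm_num) (by rw [phatopeLBs0_eq]; exact cellChk_opeLB_s0l15) (by norm_num; linarith) (by norm_num; linarith)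
    rcases le_or_gt Δ ((165 : ℝ) / 16) with hd15 | hd15
    · exact cell_nonneg_of_bernAuto_trunc wtopeLB slL15_nodup slL15_deg 0 63 409 (q := 256) (a := 1301) (L := 19) (by norm_num) (by norm_num) (by norm_num) (by rw [phatopeLBs0_eq]; exact cellChk_opeLB_s0l16) (by norm_num; linarith) (by norm_num; linarith)
    rcases le_or_gt Δ ((23 : ℝ) / 2) with hd16 | hd16
    · exact cell_nonneg_of_bernAuto_trunc wtopeLB slL15_nodup slL15_deg 0 63 419 (q := 32) (a := 165) (L := 19) (by norm_num) (by norm_num) (by norm_num) (by rw [phatopeLBs0_eq]; exact cellChk_opeLB_s0l17) (by norm_num; linarith) (by norm_num; linarith)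
    rcases le_or_gt Δ (21 : ℝ) with hd17 | hd17
    · exact cell_nonneg_of_bernAuto_trunc wtopeLB slL15_nodup slL15_deg 0 63 419 (q := 4) (a := 23) (L := 19) (by norm_num) (by norm_num) (by norm_num) (by rw [phatopeLBs0_eq]; exact cellChk_opeLB_s0l18) (by norm_num; linarith) (by norm_num; linarith)
    exact cell_nonneg_of_bernAuto_trunc wtopeLB slL15_nodup slL15_deg 0 63 419 (q := 2) (a := 21) (L := 19) (by norm_num) (by norm_num) (by norm_num) (by rw [phatopeLBs0_eq]; exact cellChk_opeLB_s0l19) (by norm_num; linarith) (by norm_num; linarith)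
  · intro Δ h1 h2
    replace h1 : (3 : ℝ) ≤ Δ := by linarith
    replace h2 := h2.le
    refine ⟨63 + 1, by norm_num, ?_⟩
    rcases le_or_gt Δ ((85 : ℝ) / 16) with hd0 | hd0
    · exact cell_nonneg_of_bernAuto_trunc wtopeLB slL15_nodup slL15_deg 2 63 426 (q := 32) (a := 16) (L := 37) (by norm_num) (by norm_num) (by norm_num) (by rw [phatopeLBs2_eq]; exact cellChk_opeLB_s2l0) (by norm_num; linarith) (by norm_num; linarith)
    rcases le_or_gt Δ ((377 : ℝ) / 64) with hd1 | hd1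
    · exact cell_nonneg_of_bernAuto_trunc wtopeLB slL15_nodup slL15_deg 2 63 426 (q := 128) (a := 212) (L := 37) (by norm_num) (by norm_num) (by norm_num) (by rw [phatopeLBs2_eq]; exact cellChk_opeLB_s2l1) (by norm_num; linarith) (by norm_num; linarith)
    rcases le_or_gt Δ ((791 : ℝ) / 128) with hd2 | hd2
    · exact cell_nonneg_of_bernAuto_trunc wtopeLB slL15_nodup slL15_deg 2 63 426 (q := 256) (a := 498) (L := 37) (by norm_num) (by norm_num) (by norm_num) (by rw [phatopeLBs2_eq]; exact cellChk_opeLB_s2l2) (by norm_num; linarith) (by norm_num; linarith)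
    rcases le_or_gt Δ ((207 : ℝ) / 32) with hd3 | hd3
    · exact cell_nonneg_of_bernAuto_trunc wtopeLB slL15_nodup slL15_deg 2 63 426 (q := 256) (a := 535) (L := 37) (by norm_num) (by norm_num) (by norm_num) (by rw [phatopeLBs2_eq]; exact cellChk_opeLB_s2l3) (by norm_num; linarith) (by norm_num; linarith)
    rcases le_or_gt Δ ((61 : ℝ) / 8) with hd4 | hd4
    · exact cell_nonneg_of_bernAuto_trunc wtopeLB slL15_nodup slL15_deg 2 63 426 (q := 64) (a := 143) (L := 37) (by norm_num) (by norm_num) (by norm_num) (by rw [phatopeLBs2_eq]; exact cellChk_opeLB_s2l4) (by norm_num; linarith) (by norm_num; linarith)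
    rcases le_or_gt Δ ((49 : ℝ) / 4) with hd5 | hd5
    · exact cell_nonneg_of_bernAuto_trunc wtopeLB slL15_nodup slL15_deg 2 63 426 (q := 16) (a := 45) (L := 37) (by norm_num) (by norm_num) (by norm_num) (by rw [phatopeLBs2_eq]; exact cellChk_opeLB_s2l5) (by norm_num; linarith) (by norm_num; linarith)
    rcases le_or_gt Δ ((43 : ℝ) / 2) with hd6 | hd6
    · exact cell_nonneg_of_bernAuto_trunc wtopeLB slL15_nodup slL15_deg 2 63 426 (q := 8) (a := 41) (L := 37) (by norm_num) (by norm_num) (by norm_num) (by rw [phatopeLBs2_eq]; exact cellChk_opeLB_s2l6) (by norm_num; linarith) (by norm_num; linarith)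
    exact cell_nonneg_of_bernAuto_trunc wtopeLB slL15_nodup slL15_deg 2 63 426 (q := 4) (a := 39) (L := 37) (by norm_num) (by norm_num) (by norm_num) (by rw [phatopeLBs2_eq]; exact cellChk_opeLB_s2l7) (by norm_num; linarith) (by norm_num; linarith)
  · intro ℓ hℓ hℓ0 hℓ2 Δ hℓΔ hΔ
    have hℓR : (ℓ : ℝ) < 40 := lt_of_le_of_lt hℓΔ hΔ
    have hℓE : ℓ < 40 := by exact_mod_cast hℓR
    replace h2 := hΔ.le
    interval_cases ℓ
    · exact absurd rfl hℓ0
    · exact absurd hℓ (by decide)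
    · exact absurd rfl hℓ2
    · exact absurd hℓ (by decide)
    · have h1 : (4 : ℝ) ≤ Δ := by exact_mod_cast hℓΔ
      refine ⟨63 + 1, by norm_num, ?_⟩
      rcases le_or_gt Δ ((41 : ℝ) / 8) with hd0 | hd0
      · exact cell_nonneg_of_bernAuto_trunc wtopeLB slL15_nodup slL15_deg 4 63 431 (q := 16) (a := 0) (L := 9) (by norm_num) (by norm_num) (by norm_num) (by rw [phatopeLBs4_eq]; exact cellChk_opeLB_s4l0) (by norm_num; linarith) (by norm_num; linarith)
      rcases le_or_gt Δ ((25 : ℝ) / 4) with hd1 | hd1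
      · exact cell_nonneg_of_bernAuto_trunc wtopeLB slL15_nodup slL15_deg 4 63 431 (q := 16) (a := 9) (L := 9) (by norm_num) (by norm_num) (by norm_num) (by rw [phatopeLBs4_eq]; exact cellChk_opeLB_s4l1) (by norm_num; linarith) (by norm_num; linarith)
      rcases le_or_gt Δ ((59 : ℝ) / 8) with hd2 | hd2
      · exact cell_nonneg_of_bernAuto_trunc wtopeLB slL15_nodup slL15_deg 4 63 431 (q := 16) (a := 18) (L := 9) (by norm_num) (by norm_num) (by norm_num) (by rw [phatopeLBs4_eq]; exact cellChk_opeLB_s4l2) (by norm_num; linarith) (by norm_num; linarith)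
      rcases le_or_gt Δ ((127 : ℝ) / 16) with hd3 | hd3
      · exact cell_nonneg_of_bernAuto_trunc wtopeLB slL15_nodup slL15_deg 4 63 431 (q := 32) (a := 54) (L := 9) (by norm_num) (by norm_num) (by norm_num) (by rw [phatopeLBs4_eq]; exact cellChk_opeLB_s4l3) (by norm_num; linarith) (by norm_num; linarith)
      rcases le_or_gt Δ ((263 : ℝ) / 32) with hd4 | hd4
      · exact cell_nonneg_of_bernAuto_trunc wtopeLB slL15_nodup slL15_deg 4 63 431 (q := 64) (a := 126) (L := 9) (by norm_num) (by norm_num) (by norm_num) (by rw [phatopeLBs4_eq]; exact cellChk_opeLB_s4l4) (by norm_num; linarith) (by norm_num; linarith)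
      rcases le_or_gt Δ ((17 : ℝ) / 2) with hd5 | hd5
      · exact cell_nonneg_of_bernAuto_trunc wtopeLB slL15_nodup slL15_deg 4 63 431 (q := 64) (a := 135) (L := 9) (by norm_num) (by norm_num) (by norm_num) (by rw [phatopeLBs4_eq]; exact cellChk_opeLB_s4l5) (by norm_num; linarith) (by norm_num; linarith)
      rcases le_or_gt Δ (13 : ℝ) with hd6 | hd6
      · exact cell_nonneg_of_bernAuto_trunc wtopeLB slL15_nodup slL15_deg 4 63 431 (q := 4) (a := 9) (L := 9) (by norm_num) (by norm_num) (by norm_num) (by rw [phatopeLBs4_eq]; exact cellChk_opeLB_s4l6) (by norm_num; linarith) (by norm_num; linarith)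
      rcases le_or_gt Δ (22 : ℝ) with hd7 | hd7
      · exact cell_nonneg_of_bernAuto_trunc wtopeLB slL15_nodup slL15_deg 4 63 431 (q := 2) (a := 9) (L := 9) (by norm_num) (by norm_num) (by norm_num) (by rw [phatopeLBs4_eq]; exact cellChk_opeLB_s4l7) (by norm_num; linarith) (by norm_num; linarith)
      exact cell_nonneg_of_bernAuto_trunc wtopeLB slL15_nodup slL15_deg 4 63 431 (q := 1) (a := 9) (L := 9) (by norm_num) (by norm_num) (by norm_num) (by rw [phatopeLBs4_eq]; exact cellChk_opeLB_s4l8) (by norm_num; linarith) (by norm_num; linarith)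
    · exact absurd hℓ (by decide)
    · have h1 : (6 : ℝ) ≤ Δ := by exact_mod_cast hℓΔ
      refine ⟨63 + 1, by norm_num, ?_⟩
      rcases le_or_gt Δ ((209 : ℝ) / 32) with hd0 | hd0
      · exact cell_nonneg_of_bernAuto_trunc wtopeLB slL15_nodup slL15_deg 6 63 436 (q := 64) (a := 0) (L := 17) (by norm_num) (by norm_num) (by norm_num) (by rw [phatopeLBs6_eq]; exact cellChk_opeLB_s6l0) (by norm_num; linarith) (by norm_num; linarith)
      rcases le_or_gt Δ ((113 : ℝ) / 16) with hd1 | hd1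
      · exact cell_nonneg_of_bernAuto_trunc wtopeLB slL15_nodup slL15_deg 6 63 436 (q := 64) (a := 17) (L := 17) (by norm_num) (by norm_num) (by norm_num) (by rw [phatopeLBs6_eq]; exact cellChk_opeLB_s6l1) (by norm_num; linarith) (by norm_num; linarith)
      rcases le_or_gt Δ ((65 : ℝ) / 8) with hd2 | hd2
      · exact cell_nonneg_of_bernAuto_trunc wtopeLB slL15_nodup slL15_deg 6 63 436 (q := 32) (a := 17) (L := 17) (by norm_num) (by norm_num) (by norm_num) (by rw [phatopeLBs6_eq]; exact cellChk_opeLB_s6l2) (by norm_num; linarith) (by norm_num; linarith)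
      rcases le_or_gt Δ ((41 : ℝ) / 4) with hd3 | hd3
      · exact cell_nonneg_of_bernAuto_trunc wtopeLB slL15_nodup slL15_deg 6 63 436 (q := 16) (a := 17) (L := 17) (by norm_num) (by norm_num) (by norm_num) (by rw [phatopeLBs6_eq]; exact cellChk_opeLB_s6l3) (by norm_num; linarith) (by norm_num; linarith)
      rcases le_or_gt Δ ((673 : ℝ) / 64) with hd4 | hd4
      · exact cell_nonneg_of_bernAuto_trunc wtopeLB slL15_nodup slL15_deg 6 63 436 (q := 128) (a := 272) (L := 17) (by norm_num) (by norm_num) (by norm_num) (by rw [phatopeLBs6_eq]; exact cellChk_opeLB_s6l4) (by norm_num; linarith) (by norm_num; linarith)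
      rcases le_or_gt Δ ((345 : ℝ) / 32) with hd5 | hd5
      · exact cell_nonneg_of_bernAuto_trunc wtopeLB slL15_nodup slL15_deg 6 63 436 (q := 128) (a := 289) (L := 17) (by norm_num) (by norm_num) (by norm_num) (by rw [phatopeLBs6_eq]; exact cellChk_opeLB_s6l5) (by norm_num; linarith) (by norm_num; linarith)
      rcases le_or_gt Δ ((181 : ℝ) / 16) with hd6 | hd6
      · exact cell_nonneg_of_bernAuto_trunc wtopeLB slL15_nodup slL15_deg 6 63 436 (q := 64) (a := 153) (L := 17) (by norm_num) (by norm_num) (by norm_num) (by rw [phatopeLBs6_eq]; exact cellChk_opeLB_s6l6) (by norm_num; linarith) (by norm_num; linarith)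
      rcases le_or_gt Δ ((99 : ℝ) / 8) with hd7 | hd7
      · exact cell_nonneg_of_bernAuto_trunc wtopeLB slL15_nodup slL15_deg 6 63 436 (q := 32) (a := 85) (L := 17) (by norm_num) (by norm_num) (by norm_num) (by rw [phatopeLBs6_eq]; exact cellChk_opeLB_s6l7) (by norm_num; linarith) (by norm_num; linarith)
      rcases le_or_gt Δ ((29 : ℝ) / 2) with hd8 | hd8
      · exact cell_nonneg_of_bernAuto_trunc wtopeLB slL15_nodup slL15_deg 6 63 436 (q := 16) (a := 51) (L := 17) (by norm_num) (by norm_num) (by norm_num) (by rw [phatopeLBs6_eq]; exact cellChk_opeLB_s6l8) (by norm_num; linarith) (by norm_num; linarith)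
      rcases le_or_gt Δ (23 : ℝ) with hd9 | hd9
      · exact cell_nonneg_of_bernAuto_trunc wtopeLB slL15_nodup slL15_deg 6 63 436 (q := 4) (a := 17) (L := 17) (by norm_num) (by norm_num) (by norm_num) (by rw [phatopeLBs6_eq]; exact cellChk_opeLB_s6l9) (by norm_num; linarith) (by norm_num; linarith)
      exact cell_nonneg_of_bernAuto_trunc wtopeLB slL15_nodup slL15_deg 6 63 436 (q := 2) (a := 17) (L := 17) (by norm_num) (by norm_num) (by norm_num) (by rw [phatopeLBs6_eq]; exact cellChk_opeLB_s6l10) (by norm_num; linarith) (by norm_num; linarith)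
    · exact absurd hℓ (by decide)
    · have h1 : (8 : ℝ) ≤ Δ := by exact_mod_cast hℓΔ
      refine ⟨55 + 1, by norm_num, ?_⟩
      rcases le_or_gt Δ (9 : ℝ) with hd0 | hd0
      · exact cell_nonneg_of_bernAuto_trunc wtopeLB slL15_nodup slL15_deg 8 55 377 (q := 2) (a := 0) (L := 1) (by norm_num) (by norm_num) (by norm_num) (by rw [phatopeLBs8_eq]; exact cellChk_opeLB_s8l0) (by norm_num; linarith) (by norm_num; linarith)
      rcases le_or_gt Δ (10 : ℝ) with hd1 | hd1
      · exact cell_nonneg_of_bernAuto_trunc wtopeLB slL15_nodup slL15_deg 8 55 377 (q := 2) (a := 1) (L := 1) (by norm_num) (by norm_num) (by norm_num) (by rw [phatopeLBs8_eq]; exact cellChk_opeLB_s8l1) (by norm_num; linarith) (by norm_num; linarith)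
      rcases le_or_gt Δ ((21 : ℝ) / 2) with hd2 | hd2
      · exact cell_nonneg_of_bernAuto_trunc wtopeLB slL15_nodup slL15_deg 8 55 377 (q := 4) (a := 4) (L := 1) (by norm_num) (by norm_num) (by norm_num) (by rw [phatopeLBs8_eq]; exact cellChk_opeLB_s8l2) (by norm_num; linarith) (by norm_num; linarith)
      rcases le_or_gt Δ ((43 : ℝ) / 4) with hd3 | hd3
      · exact cell_nonneg_of_bernAuto_trunc wtopeLB slL15_nodup slL15_deg 8 55 377 (q := 8) (a := 10) (L := 1) (by norm_num) (by norm_num) (by norm_num) (by rw [phatopeLBs8_eq]; exact cellChk_opeLB_s8l3) (by norm_num; linarith) (by norm_num; linarith)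
      rcases le_or_gt Δ ((87 : ℝ) / 8) with hd4 | hd4
      · exact cell_nonneg_of_bernAuto_trunc wtopeLB slL15_nodup slL15_deg 8 55 377 (q := 16) (a := 22) (L := 1) (by norm_num) (by norm_num) (by norm_num) (by rw [phatopeLBs8_eq]; exact cellChk_opeLB_s8l4) (by norm_num; linarith) (by norm_num; linarith)
      rcases le_or_gt Δ (11 : ℝ) with hd5 | hd5
      · exact cell_nonneg_of_bernAuto_trunc wtopeLB slL15_nodup slL15_deg 8 55 377 (q := 16) (a := 23) (L := 1) (by norm_num) (by norm_num) (by norm_num) (by rw [phatopeLBs8_eq]; exact cellChk_opeLB_s8l5) (by norm_num; linarith) (by norm_num; linarith)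
      rcases le_or_gt Δ (12 : ℝ) with hd6 | hd6
      · exact cell_nonneg_of_bernAuto_trunc wtopeLB slL15_nodup slL15_deg 8 55 377 (q := 2) (a := 3) (L := 1) (by norm_num) (by norm_num) (by norm_num) (by rw [phatopeLBs8_eq]; exact cellChk_opeLB_s8l6) (by norm_num; linarith) (by norm_num; linarith)
      rcases le_or_gt Δ (16 : ℝ) with hd7 | hd7
      · exact cell_nonneg_of_bernAuto_trunc wtopeLB slL15_nodup slL15_deg 8 55 377 (q := 1) (a := 2) (L := 2) (by norm_num) (by norm_num) (by norm_num) (by rw [phatopeLBs8_eq]; exact cellChk_opeLB_s8l7) (by norm_num; linarith) (by norm_num; linarith)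
      rcases le_or_gt Δ (24 : ℝ) with hd8 | hd8
      · exact cell_nonneg_of_bernAuto_trunc wtopeLB slL15_nodup slL15_deg 8 55 377 (q := 1) (a := 4) (L := 4) (by norm_num) (by norm_num) (by norm_num) (by rw [phatopeLBs8_eq]; exact cellChk_opeLB_s8l8) (by norm_num; linarith) (by norm_num; linarith)
      exact cell_nonneg_of_bernAuto_trunc wtopeLB slL15_nodup slL15_deg 8 55 377 (q := 1) (a := 8) (L := 8) (by norm_num) (by norm_num) (by norm_num) (by rw [phatopeLBs8_eq]; exact cellChk_opeLB_s8l9) (by norm_num; linarith) (by norm_num; linarith)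
    · exact absurd hℓ (by decide)
    · have h1 : (10 : ℝ) ≤ Δ := by exact_mod_cast hℓΔ
      refine ⟨55 + 1, by norm_num, ?_⟩
      rcases le_or_gt Δ ((175 : ℝ) / 16) with hd0 | hd0
      · exact cell_nonneg_of_bernAuto_trunc wtopeLB slL15_nodup slL15_deg 10 55 381 (q := 32) (a := 0) (L := 15) (by norm_num) (by norm_num) (by norm_num) (by rw [phatopeLBs10_eq]; exact cellChk_opeLB_s10l0) (by norm_num; linarith) (by norm_num; linarith)
      rcases le_or_gt Δ ((95 : ℝ) / 8) with hd1 | hd1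
      · exact cell_nonneg_of_bernAuto_trunc wtopeLB slL15_nodup slL15_deg 10 55 381 (q := 32) (a := 15) (L := 15) (by norm_num) (by norm_num) (by norm_num) (by rw [phatopeLBs10_eq]; exact cellChk_opeLB_s10l1) (by norm_num; linarith) (by norm_num; linarith)
      rcases le_or_gt Δ ((55 : ℝ) / 4) with hd2 | hd2
      · exact cell_nonneg_of_bernAuto_trunc wtopeLB slL15_nodup slL15_deg 10 55 381 (q := 16) (a := 15) (L := 15) (by norm_num) (by norm_num) (by norm_num) (by rw [phatopeLBs10_eq]; exact cellChk_opeLB_s10l2) (by norm_num; linarith) (by norm_num; linarith)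
      rcases le_or_gt Δ ((35 : ℝ) / 2) with hd3 | hd3
      · exact cell_nonneg_of_bernAuto_trunc wtopeLB slL15_nodup slL15_deg 10 55 381 (q := 8) (a := 15) (L := 15) (by norm_num) (by norm_num) (by norm_num) (by rw [phatopeLBs10_eq]; exact cellChk_opeLB_s10l3) (by norm_num; linarith) (by norm_num; linarith)
      rcases le_or_gt Δ (25 : ℝ) with hd4 | hd4
      · exact cell_nonneg_of_bernAuto_trunc wtopeLB slL15_nodup slL15_deg 10 55 381 (q := 4) (a := 15) (L := 15) (by norm_num) (by norm_num) (by norm_num) (by rw [phatopeLBs10_eq]; exact cellChk_opeLB_s10l4) (by norm_num; linarith) (by norm_num; linarith)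
      exact cell_nonneg_of_bernAuto_trunc wtopeLB slL15_nodup slL15_deg 10 55 381 (q := 2) (a := 15) (L := 15) (by norm_num) (by norm_num) (by norm_num) (by rw [phatopeLBs10_eq]; exact cellChk_opeLB_s10l5) (by norm_num; linarith) (by norm_num; linarith)
    · exact absurd hℓ (by decide)
    · have h1 : (12 : ℝ) ≤ Δ := by exact_mod_cast hℓΔ
      refine ⟨39 + 1, by norm_num, ?_⟩
      exact cell_nonneg_of_bernAuto_trunc wtopeLB slL15_nodup slL15_deg 12 39 265 (q := 1) (a := 0) (L := 14) (by norm_num) (by norm_num) (by norm_num) (by rw [phatopeLBs12_eq]; exact cellChk_opeLB_s12l0) (by norm_num; linarith) (by norm_num; linarith)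
    · exact absurd hℓ (by decide)
    · have h1 : (14 : ℝ) ≤ Δ := by exact_mod_cast hℓΔ
      refine ⟨39 + 1, by norm_num, ?_⟩
      exact cell_nonneg_of_bernAuto_trunc wtopeLB slL15_nodup slL15_deg 14 39 268 (q := 1) (a := 0) (L := 13) (by norm_num) (by norm_num) (by norm_num) (by rw [phatopeLBs14_eq]; exact cellChk_opeLB_s14l0) (by norm_num; linarith) (by norm_num; linarith)
    · exact absurd hℓ (by decide)
    · have h1 : (16 : ℝ) ≤ Δ := by exact_mod_cast hℓΔ
      refine ⟨39 + 1, by norm_num, ?_⟩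
      exact cell_nonneg_of_bernAuto_trunc wtopeLB slL15_nodup slL15_deg 16 39 270 (q := 1) (a := 0) (L := 12) (by norm_num) (by norm_num) (by norm_num) (by rw [phatopeLBs16_eq]; exact cellChk_opeLB_s16l0) (by norm_num; linarith) (by norm_num; linarith)
    · exact absurd hℓ (by decide)
    · have h1 : (18 : ℝ) ≤ Δ := by exact_mod_cast hℓΔ
      refine ⟨39 + 1, by norm_num, ?_⟩
      exact cell_nonneg_of_bernAuto_trunc wtopeLB slL15_nodup slL15_deg 18 39 273 (q := 1) (a := 0) (L := 11) (by norm_num) (by norm_num) (by norm_num) (by rw [phatopeLBs18_eq]; exact cellChk_opeLB_s18l0) (by norm_num; linarith) (by norm_num; linarith)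
    · exact absurd hℓ (by decide)
    · have h1 : (20 : ℝ) ≤ Δ := by exact_mod_cast hℓΔ
      refine ⟨39 + 1, by norm_num, ?_⟩
      exact cell_nonneg_of_bernAuto_trunc wtopeLB slL15_nodup slL15_deg 20 39 275 (q := 1) (a := 0) (L := 10) (by norm_num) (by norm_num) (by norm_num) (by rw [phatopeLBs20_eq]; exact cellChk_opeLB_s20l0) (by norm_num; linarith) (by norm_num; linarith)
    · exact absurd hℓ (by decide)
    · have h1 : (22 : ℝ) ≤ Δ := by exact_mod_cast hℓΔ
      refine ⟨39 + 1, by norm_num, ?_⟩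
      exact cell_nonneg_of_bernAuto_trunc wtopeLB slL15_nodup slL15_deg 22 39 277 (q := 1) (a := 0) (L := 9) (by norm_num) (by norm_num) (by norm_num) (by rw [phatopeLBs22_eq]; exact cellChk_opeLB_s22l0) (by norm_num; linarith) (by norm_num; linarith)
    · exact absurd hℓ (by decide)
    · have h1 : (24 : ℝ) ≤ Δ := by exact_mod_cast hℓΔ
      refine ⟨39 + 1, by norm_num, ?_⟩
      exact cell_nonneg_of_bernAuto_trunc wtopeLB slL15_nodup slL15_deg 24 39 278 (q := 1) (a := 0) (L := 8) (by norm_num) (by norm_num) (by norm_num) (by rw [phatopeLBs24_eq]; exact cellChk_opeLB_s24l0) (by norm_num; linarith) (by norm_num; linarith)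
    · exact absurd hℓ (by decide)
    · have h1 : (26 : ℝ) ≤ Δ := by exact_mod_cast hℓΔ
      refine ⟨39 + 1, by norm_num, ?_⟩
      exact cell_nonneg_of_bernAuto_trunc wtopeLB slL15_nodup slL15_deg 26 39 280 (q := 1) (a := 0) (L := 7) (by norm_num) (by norm_num) (by norm_num) (by rw [phatopeLBs26_eq]; exact cellChk_opeLB_s26l0) (by norm_num; linarith) (by norm_num; linarith)
    · exact absurd hℓ (by decide)
    · have h1 : (28 : ℝ) ≤ Δ := by exact_mod_cast hℓΔ
      refine ⟨39 + 1, by norm_num, ?_⟩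
      exact cell_nonneg_of_bernAuto_trunc wtopeLB slL15_nodup slL15_deg 28 39 282 (q := 1) (a := 0) (L := 6) (by norm_num) (by norm_num) (by norm_num) (by rw [phatopeLBs28_eq]; exact cellChk_opeLB_s28l0) (by norm_num; linarith) (by norm_num; linarith)
    · exact absurd hℓ (by decide)
    · have h1 : (30 : ℝ) ≤ Δ := by exact_mod_cast hℓΔ
      refine ⟨39 + 1, by norm_num, ?_⟩
      exact cell_nonneg_of_bernAuto_trunc wtopeLB slL15_nodup slL15_deg 30 39 283 (q := 1) (a := 0) (L := 5) (by norm_num) (by norm_num) (by norm_num) (by rw [phatopeLBs30_eq]; exact cellChk_opeLB_s30l0) (by norm_num; linarith) (by norm_num; linarith)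
    · exact absurd hℓ (by decide)
    · have h1 : (32 : ℝ) ≤ Δ := by exact_mod_cast hℓΔ
      refine ⟨39 + 1, by norm_num, ?_⟩
      exact cell_nonneg_of_bernAuto_trunc wtopeLB slL15_nodup slL15_deg 32 39 285 (q := 1) (a := 0) (L := 4) (by norm_num) (by norm_num) (by norm_num) (by rw [phatopeLBs32_eq]; exact cellChk_opeLB_s32l0) (by norm_num; linarith) (by norm_num; linarith)
    · exact absurd hℓ (by decide)
    · have h1 : (34 : ℝ) ≤ Δ := by exact_mod_cast hℓΔ
      refine ⟨39 + 1, by norm_num, ?_⟩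
      exact cell_nonneg_of_bernAuto_trunc wtopeLB slL15_nodup slL15_deg 34 39 286 (q := 1) (a := 0) (L := 3) (by norm_num) (by norm_num) (by norm_num) (by rw [phatopeLBs34_eq]; exact cellChk_opeLB_s34l0) (by norm_num; linarith) (by norm_num; linarith)
    · exact absurd hℓ (by decide)
    · have h1 : (36 : ℝ) ≤ Δ := by exact_mod_cast hℓΔ
      refine ⟨39 + 1, by norm_num, ?_⟩
      exact cell_nonneg_of_bernAuto_trunc wtopeLB slL15_nodup slL15_deg 36 39 288 (q := 1) (a := 0) (L := 2) (by norm_num) (by norm_num) (by norm_num) (by rw [phatopeLBs36_eq]; exact cellChk_opeLB_s36l0) (by norm_num; linarith) (by norm_num; linarith)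
    · exact absurd hℓ (by decide)
    · have h1 : (38 : ℝ) ≤ Δ := by exact_mod_cast hℓΔ
      refine ⟨39 + 1, by norm_num, ?_⟩
      exact cell_nonneg_of_bernAuto_trunc wtopeLB slL15_nodup slL15_deg 38 39 289 (q := 1) (a := 0) (L := 1) (by norm_num) (by norm_num) (by norm_num) (by rw [phatopeLBs38_eq]; exact cellChk_opeLB_s38l0) (by norm_num; linarith) (by norm_num; linarith)
    · exact absurd hℓ (by decide)

/-- **2D control, γ-architecture, kind `ope2` (LOWER sense), kernel-complete: under `A2D′` at `Δ_σ = 1/8` with the `ε` box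
`[49/50, 20001/20000]`, `p_T > 38541/2500000`**, every obligation of the Λ = 15 functional checked in the Lean kernel (scalar `T` head at
`N_T = 95 + 1` levels). CONTROL-ONLY (d = 2). [cite: RattazziEtAl2008, §5.5] -/
theorem opeLower_2d_L15_opeLB : OpeLowerA2D (1 / 8 : ℝ) 2 1 (49 / 50) (20001 / 20000) (38541 / 2500000) := by
  have h := opeLower_half_of_cellsZ wtopeLB slL15_nodup slL15_deg (G := 2) (δ := 1) (e₁ := 49 / 50) (e₂ := 20001 / 20000)
    (E₀ := 40) (Pn := 38541) (Pd := 2500000) (Nd := 95) (by norm_num) (by norm_num) (by norm_num) (by norm_num)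
    (by norm_num) (by norm_num) (by decide +kernel) (by decide +kernel)
    (region_of_kernelCertAuto wtopeLB slL15_nodup slL15_deg 15 16 (by norm_num) (by norm_num) PregopeLB_eq
      (by decide +kernel) QhatopeLB_eq _ cregopeLB_n0 cregJopeLB (by decide) cregJopeLB_ok) cells_opeLB
  push_cast at h
  exact h

/-- **The `c` upper edge this certificate puts on the kernel** (by the Virasoro Ward identity `p_T = Δ_σ²/(2c)`, taken as a
HYPOTHESIS on the datum exactly as in `cTwoSided_rb6_L15`): every parity-symmetric unitary solution of the 2D sum rule at `Δ_σ = 1/8`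
under `A2D′` with the `ε` box `[49/50, 20001/20000]` whose total `(2,2)` coefficient equals `(1/8)²/(2c)` with `c > 0` has
`c < (1/8)²/(2·(38541/2500000))`, i.e. `c < 0.5067655`. CONTROL-ONLY (d = 2). [cite: RattazziEtAl2008, §5] -/
theorem cUpper_2d_L15_opeLB {D : CrossingData} (hU : D.IsUnitary) (hC : D.SatisfiesCrossing (1 / 8))
    (hS : D.ScalarsIn (Icc (49 / 50 : ℝ) (20001 / 20000) ∪ Ici 2)) (hT2 : D.SpinTwoIn ({2} ∪ Ici (2 + 1)))
    {c : ℝ} (hc : 0 < c) (hWard : D.stressCoeff = (1 / 8 : ℝ) ^ 2 / (2 * c)) :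
    c < (1 / 8 : ℝ) ^ 2 / (2 * (38541 / 2500000)) :=
  centralCharge_upper_bound hc (by norm_num) hWard (opeLower_2d_L15_opeLB D hU hC hS hT2)

end Summit.CriticalPhenomena.Ising3D.Control2D
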